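import Literature.MathematicalPhysics.QuantumFieldTheory.Balaban1983to89.B8Eq1113Concrete
import Mathlib.Analysis.Complex.CauchyIntegral

/-!
# `Balaban1983to89.B8CprimeCurveAnalytic` — T. Bałaban, *Spaces of regular gauge field configurations on a lattice and gauge
# fixing conditions*, Commun. Math. Phys. **99** (1985) 75–102 [Balaban1985RegularSpaces], Sect. E pp. 96–97: «the analyticity
# properties of `C′(λ)`» — THE CONCRETE LATTICE REMAINDER `C′ = C′_j(u₁, ·)` IS HOLOMORPHIC, AS A MAP INTO THE BANACH SPACE OF THE
# `X : 𝔅_k → 𝔤ᶜ`, ALONG EVERY HOLOMORPHIC ONE-PARAMETER FAMILY OF `λ`'s (file 1 of 3; file 2 = `B8Eq1118PicardAnalytic`: the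
# iterates of (1.118) along holomorphic families; file 3 = `B8Eq1117ConcreteAnalytic`: «This solution [`D′(λ)`] is an analytic
# function of λ»)

statement-level skeleton of published theorems with citation tags; proofs where landed; nothing here is a claim about the Yang–Mills mass gap

PDF held: `paper:balaban1985-cmp99-regular-spaces-gauge-fixing` (journal page = PDF page + 74); pp. 96–97 [PDF 22–23] read from the
text layer (`p0022.txt`, `p0023.txt`; this unit, 2026-08-21); [3] = T. Bałaban, *Averaging operations for lattice gauge theories*,
Commun. Math. Phys. **98** (1985) 17–51 [Balaban1985Averaging], (207)–(208), (213)–(214) p. 50.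

CITATION HEADER (lean-in-tree rule).  Cell `lit-balaban` (HOME `run/shared/lean/pub/lit-balaban/`), unit `lit-balaban-p05` (Phase-2 proof
seat p05, gen 6; TAKING line HOME/STATUS.md 2026-08-21T09:39:21Z; free-target protocol G.5-34(d); owner of block B8 = `lit-balaban-r05`,
referee ref-4).  WHAT IS SERVED = SKELETON rows **`B8.Eq1.113`** / **`B8.Claim@97`**, the p. 97 sentence «This solution is an
analytic function of λ defined on the set of λ satisfying (1.119)» FOR THE CONCRETE `C′`/`D′` of `B8Eq1117Concrete`/`B8Eq1113Concrete`
(this unit, gen 5).  Its input is the present file: print's «analyticity properties of `C′(λ)`» in BANACH-VALUED form.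

PRINT (p. 96 [PDF 22], p. 97 [PDF 23], verbatim).  «We may admit configurations λ, X with values in the complexified algebra 𝔤ᶜ and
all the above equations and inequalities are valid also.» … «Using the analyticity properties of C′(λ), the derivative above can be
written as (1/2πi)∮_{|τ|=r} dτ τ⁻² C′(λ + τλ₀). (1.124)» … «Thus by the contraction mapping theorem there exists exactly one solution of
Eq. (1.117). This solution is an analytic function of λ defined on the set of λ satisfying (1.119).»  The analyticity of `C′` is [3]
p. 50: «ũ′ʲ are analytic functions of λ, and Q′_j(u₁,λ) = (1/i) log ũ′ʲ, j ≤ k, (208) are analytic functions of λ also»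
(`C′(λ) = Q′(u₁,λ) − Q′λ`, (213)).

WHAT THIS FILE PROVES (kernel, no `sorry`, standard axioms; theorems only — no `def`, no `… : Prop` fact).  Carriers as in the
series: `𝔸` a complete normed `ℂ`-algebra with `‖1‖ = 1`, `U₀` `G`-valued (`G ⊂ U1` average-closed) with (52), `η = L⁻ᵏ`,
`u₁ ∈ Λ_k(U₀, α₃)`, the `X`-space `XSpace d k 𝔸` (bounded functions on `Fin (k+1) × ℤᵈ`, sup norm) and `CnlF` = `C′(μ)` packaged
in it (`B8Eq1117Concrete`).
* §1 `hasFPowerSeriesOnBall_bcf_of_apply` / `differentiableOn_bcf_of_apply` / `analyticOnNhd_bcf_of_apply` — functional-analytic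
  plumbing (one complex variable): a map `f : ℂ → (ι →ᵇ 𝔹)` into the sup-normed bounded functions on a discrete index set with
  values in a complex Banach space, whose COORDINATES `t ↦ f t i` are holomorphic on an open `U` and which is BOUNDED there, is
  holomorphic (indeed analytic) on `U` as a Banach-valued map.  Proof: on a closed disc in `U` every coordinate has the Cauchy power
  series (Mathlib `DifferentiableOn.hasFPowerSeriesOnBall`) whose coefficients obey the Cauchy estimate `‖aₙ‖ ≤ M R⁻ⁿ` UNIFORMLY in
  the coordinate (`norm_cauchyPowerSeries_le`); the coefficient families are therefore bounded functions `Aₙ` with `‖Aₙ‖ ≤ M R⁻ⁿ`,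
  the Banach-valued series `Σ yⁿAₙ` converges in norm for `|y| < R`, and its sum has the right coordinates (evaluation is a
  continuous linear map), hence equals `f`.  (The sup-norm special case of Dunford's weak-to-strong holomorphy theorem,
  Hille–Phillips Thm 3.10.1; the tree's `Literature.Analysis.Complex.WeakHolomorphy` needs ALL functionals and so does not apply to
  coordinate evaluations.)
* §2 **`differentiableOn_CnlF_comp`** / **`analyticOnNhd_CnlF_comp`** — «the analyticity properties of `C′(λ)`» IN BANACH-VALUED FORM:
  for every family `γ : V → (ℤᵈ → 𝔸)`, `V ⊂ ℂ` open, which is sitewise holomorphic (`t ↦ γ(t)(x)` holomorphic on `V` for every site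
  `x`) and takes values in the (207)-domain (= print's (1.120): `‖R(U₀(b))γ(t)(b₊) − γ(t)(b₋)‖ < α₄η`, `‖γ(t)(x)‖ < α₄`), the map
  `t ↦ C′(γ(t)) ∈ XSpace` is holomorphic, indeed analytic, on `V`: coordinates by (208) (`B8Eq1123Concrete.analyticAt_Cnl_family`, from
  r04's `B7Eq208Analytic`), the bound by (1.121) (`norm_Cnl_le_of207`), assembled by §1.  (Files 2–3 iterate (1.118) along such
  families and pass to the limit `D′`.)
READINGS.  (a) «analytic in λ» is read, on the infinite lattice `ℤᵈ` of the series, as holomorphy ALONG HOLOMORPHIC ONE-PARAMETER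
FAMILIES (the G-holomorphic / curve form — the form print USES in (1.124), `τ ↦ C′(λ + τλ₀)`), with values in the Banach space of the
`X`'s; on a Banach space `Λ` of `λ`'s normed by `max{|λ|, Lᵏ|Dλ|}` (unit r05, `B8Eq1119LambdaSpace`, in progress) §2 is exactly
G-holomorphy + boundedness of `C′`, whence Fréchet analyticity by the tree's Graves–Taylor–Hille–Zorn theorem
(`Literature.Analysis.Complex.GateauxHolomorphic.differentiableOn_of_gateaux_of_bounded`, `HolomorphicBanach.analyticOnNhd_of_differentiableOn`)
— that knitting is NOT done here.  (b) `𝔤ᶜ`-values, `|·|` = the norm of `𝔸`, one-level (207)-domain, `H′` abstract: as in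
`B8Eq1117Concrete` READINGS (a)–(c).  NOT CLAIMED: anything about the lattice `H′` (row B8.Eq1.91); Fréchet analyticity on a Banach
space of `λ`'s.
REUSED BY NAME: `B8Eq1117Concrete.XSpace, CnlF, CnlF_apply, norm_Cnl_le_of207`, `B8Eq1123Concrete.Cnl, analyticAt_Cnl_family`,
`B8Ineq125Concrete.C2p, C2p_nonneg`, Mathlib `DifferentiableOn.hasFPowerSeriesOnBall`,
`cauchyPowerSeries`, `norm_cauchyPowerSeries_le`, `ContinuousMultilinearMap.mkPiRing`, `FormalMultilinearSeries.le_radius_of_bound`,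
`BoundedContinuousFunction.evalCLM`, `DifferentiableOn.analyticOnNhd`.
Unit `lit-balaban-p05` (gen 6), 2026-08-21.  Nothing here is new mathematics.

[cite: Balaban1985RegularSpaces, p.96 (𝔤ᶜ-values sentence), (1.118)–(1.121) p.96, (1.124) p.97, p.97 («This solution is an analytic
function of λ defined on the set of λ satisfying (1.119)»); Balaban1985Averaging, (208), (213)–(214) p.50]
-/

noncomputable section

open NormedSpace Finset Metric Set Filter
open scoped BoundedContinuousFunction Topology NNReal

namespace Literature.MathematicalPhysics.QuantumFieldTheory.Balaban1983to89.B8CprimeCurveAnalytic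

open B7Prop1Explicit B7Prop2Explicit MatrixLog B7Eq167Flat B7Prop9Flat B7Prop10General
open B7Prop10Flat (one_le_C5 C4'_nonneg C5'_nonneg)
open B7Eq214General (Cgen)
open B7Eq170Flat (cj)
open B8Eq1123Concrete (Cnl analyticAt_Cnl_family)
open B8Ineq125Concrete (C2p C2p_nonneg)
open B8Eq1117Concrete (XSpace CnlF CnlF_apply norm_Cnl_le_of207)

-- `Site` alone would resolve to the torus sites of `Setup.lean`; re-export the `ℤ^d` sites of `B7Prop1Explicit`.
export B7Prop1Explicit (Site)

variable {d : ℕ}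

/-! ## §1 Plumbing: a bounded map into `ι →ᵇ 𝔹` with holomorphic coordinates is holomorphic -/

section Assembly

variable {ι : Type*} [TopologicalSpace ι] [DiscreteTopology ι]
variable {𝔹 : Type*} [NormedAddCommGroup 𝔹] [NormedSpace ℂ 𝔹] [CompleteSpace 𝔹]

omit [TopologicalSpace ι] [DiscreteTopology ι] [CompleteSpace 𝔹] in
/-- **Cauchy's estimate for the coefficients of the Cauchy power series**: `‖g‖ ≤ M` on the circle `|z − c| = R` (`R > 0`) gives
`‖(cauchyPowerSeries g c R) n‖ ≤ M·R⁻ⁿ` (Mathlib `norm_cauchyPowerSeries_le` with the integral bounded by `2πM`).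
[cite: Balaban1985RegularSpaces, (1.124)–(1.125) p.97 (Cauchy estimate on the circle |τ| = r)] (functional-analytic plumbing; our proof) -/
theorem norm_cauchyPowerSeries_le_of_bound {g : ℂ → 𝔹} {c : ℂ} {R M : ℝ} (hR : 0 < R)
    (hM : ∀ θ : ℝ, ‖g (circleMap c R θ)‖ ≤ M) (n : ℕ) :
    ‖cauchyPowerSeries g c R n‖ ≤ M * (R⁻¹) ^ n := by
  have h := norm_cauchyPowerSeries_le g c R n
  have hint : ∫ θ : ℝ in (0 : ℝ)..2 * Real.pi, ‖g (circleMap c R θ)‖ ≤ 2 * Real.pi * M := by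
    have h1 := intervalIntegral.norm_integral_le_of_norm_le_const (a := (0 : ℝ)) (b := 2 * Real.pi)
      (f := fun θ => ‖g (circleMap c R θ)‖) (C := M) (fun θ _ => by rw [Real.norm_eq_abs, abs_norm]; exact hM θ)
    calc ∫ θ : ℝ in (0 : ℝ)..2 * Real.pi, ‖g (circleMap c R θ)‖
        ≤ ‖∫ θ : ℝ in (0 : ℝ)..2 * Real.pi, ‖g (circleMap c R θ)‖‖ := Real.le_norm_self _
      _ ≤ M * |2 * Real.pi - 0| := h1
      _ = 2 * Real.pi * M := by rw [sub_zero, abs_of_pos Real.two_pi_pos]; ring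
  have hRn : 0 ≤ |R|⁻¹ ^ n := by positivity
  calc ‖cauchyPowerSeries g c R n‖
      ≤ ((2 * Real.pi)⁻¹ * ∫ θ : ℝ in (0 : ℝ)..2 * Real.pi, ‖g (circleMap c R θ)‖) * |R|⁻¹ ^ n := h
    _ ≤ ((2 * Real.pi)⁻¹ * (2 * Real.pi * M)) * |R|⁻¹ ^ n := by
        gcongr
    _ = M * (R⁻¹) ^ n := by
        rw [abs_of_pos hR]
        field_simp

/-- **A bounded map into the sup-normed bounded functions with holomorphic coordinates has a Banach-valued power series** on every
closed disc of holomorphy: if every coordinate `t ↦ f t i` is complex differentiable on `closedBall c R` (`R > 0`) and `‖f t‖ ≤ M`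
there, then `f` has a power series on `ball c R` as an `(ι →ᵇ 𝔹)`-valued map (coefficients = the bounded families of the Cauchy
coefficients of the coordinates, `‖Aₙ‖ ≤ M R⁻ⁿ`).  The sup-norm case of Dunford's weak-to-strong holomorphy theorem.
[cite: Balaban1985RegularSpaces, (1.124) p.97 («Using the analyticity properties of C′(λ)»)] (functional-analytic plumbing; our proof) -/
theorem hasFPowerSeriesOnBall_bcf_of_apply {f : ℂ → ι →ᵇ 𝔹} {c : ℂ} {R : ℝ≥0} {M : ℝ} (hR : 0 < R)
    (hd : ∀ i, DifferentiableOn ℂ (fun t => f t i) (closedBall c R))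
    (hM : ∀ t ∈ closedBall c (R : ℝ), ‖f t‖ ≤ M) :
    ∃ P : FormalMultilinearSeries ℂ ℂ (ι →ᵇ 𝔹), (∀ n, ‖P n‖ ≤ M * ((R : ℝ)⁻¹) ^ n) ∧ HasFPowerSeriesOnBall f P c R := by
  have hR' : (0 : ℝ) < R := hR
  -- the coordinate power series (Cauchy)
  have hps : ∀ i, HasFPowerSeriesOnBall (fun t => f t i) (cauchyPowerSeries (fun t => f t i) c R) c R :=
    fun i => (hd i).hasFPowerSeriesOnBall hR
  have hM0 : 0 ≤ M := (norm_nonneg _).trans (hM c (mem_closedBall_self hR'.le))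
  -- the Cauchy coefficients of the coordinates and their uniform bound
  set a : ι → ℕ → 𝔹 := fun i n =>
    (2 * Real.pi * Complex.I : ℂ)⁻¹ • ∮ z in C(c, R), (z - c)⁻¹ ^ n • (z - c)⁻¹ • f z i with ha
  have hpa : ∀ i n, cauchyPowerSeries (fun t => f t i) c R n = ContinuousMultilinearMap.mkPiRing ℂ (Fin n) (a i n) :=
    fun i n => rfl
  have hab : ∀ i n, ‖a i n‖ ≤ M * ((R : ℝ)⁻¹) ^ n := fun i n => by
    rw [← ContinuousMultilinearMap.norm_mkPiRing (𝕜 := ℂ) (ι := Fin n) (a i n), ← hpa]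
    refine norm_cauchyPowerSeries_le_of_bound hR' (fun θ => ?_) n
    exact (BoundedContinuousFunction.norm_coe_le_norm (f _) i).trans (hM _ (circleMap_mem_closedBall c hR'.le θ))
  -- the coefficient families as bounded functions, and the Banach-valued series
  set A : ℕ → ι →ᵇ 𝔹 := fun n =>
    BoundedContinuousFunction.ofNormedAddCommGroupDiscrete (fun i => a i n) (M * ((R : ℝ)⁻¹) ^ n) fun i => hab i n with hA
  have hAi : ∀ n i, A n i = a i n := fun n i => rfl
  have hAn : ∀ n, ‖A n‖ ≤ M * ((R : ℝ)⁻¹) ^ n := fun n =>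
    (BoundedContinuousFunction.norm_le (by positivity)).2 fun i => hab i n
  set P : FormalMultilinearSeries ℂ ℂ (ι →ᵇ 𝔹) := fun n => ContinuousMultilinearMap.mkPiRing ℂ (Fin n) (A n) with hP
  have hPn : ∀ n, ‖P n‖ = ‖A n‖ := fun n => ContinuousMultilinearMap.norm_mkPiRing _
  refine ⟨P, fun n => (hPn n).le.trans (hAn n), ?_⟩
  refine { r_le := ?_, r_pos := ENNReal.coe_pos.2 hR, hasSum := ?_ }
  · refine FormalMultilinearSeries.le_radius_of_bound P M fun n => ?_
    rw [hPn]
    calc ‖A n‖ * (R : ℝ) ^ n ≤ M * ((R : ℝ)⁻¹) ^ n * (R : ℝ) ^ n := by gcongr; exact hAn n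
      _ = M := by rw [mul_assoc, ← mul_pow, inv_mul_cancel₀ hR'.ne', one_pow, mul_one]
  · intro y hy
    have hy' : ‖y‖ < R := by
      rw [Metric.mem_eball, edist_zero_right, enorm_lt_coe] at hy
      exact_mod_cast hy
    have hterm : (fun n => P n fun _ => y) = fun n => y ^ n • A n := by
      funext n
      simp only [hP, ContinuousMultilinearMap.mkPiRing_apply, Fin.prod_const]
    -- norm convergence by geometric domination
    have hq0 : 0 ≤ ‖y‖ / R := by positivity
    have hq : ‖y‖ / R < 1 := (div_lt_one hR').2 hy'
    have hbound : ∀ n, ‖y ^ n • A n‖ ≤ M * (‖y‖ / R) ^ n := fun n => by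
      rw [norm_smul, norm_pow]
      calc ‖y‖ ^ n * ‖A n‖ ≤ ‖y‖ ^ n * (M * ((R : ℝ)⁻¹) ^ n) := by gcongr; exact hAn n
        _ = M * (‖y‖ / R) ^ n := by rw [div_eq_mul_inv, mul_pow]; ring
    have hsum : Summable fun n => y ^ n • A n :=
      Summable.of_norm_bounded ((summable_geometric_of_lt_one hq0 hq).mul_left M) hbound
    obtain ⟨S, hS⟩ := hsum
    -- the sum has the right coordinates
    have hSi : ∀ i, S i = f (c + y) i := fun i => by
      have h1 : HasSum (fun n => (y ^ n • A n) i) (S i) := by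
        simpa only [BoundedContinuousFunction.evalCLM_apply] using
          ((BoundedContinuousFunction.evalCLM ℂ i).hasSum hS)
      have h2 : HasSum (fun n => cauchyPowerSeries (fun t => f t i) c R n fun _ => y) (f (c + y) i) :=
        (hps i).hasSum hy
      have h3 : (fun n => cauchyPowerSeries (fun t => f t i) c R n fun _ => y) = fun n => (y ^ n • A n) i := by
        funext n
        rw [hpa, ContinuousMultilinearMap.mkPiRing_apply, Fin.prod_const]
        rfl
      rw [h3] at h2
      exact h1.unique h2
    have hSeq : S = f (c + y) := BoundedContinuousFunction.ext hSi
    rw [hterm, ← hSeq]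
    exact hS

/-- **A bounded map into `ι →ᵇ 𝔹` with holomorphic coordinates is holomorphic**: `U ⊂ ℂ` open, every coordinate `t ↦ f t i`
complex differentiable on `U`, `‖f t‖ ≤ M` on `U` ⇒ `f : ℂ → (ι →ᵇ 𝔹)` is complex differentiable on `U`.
[cite: Balaban1985RegularSpaces, (1.124) p.97 («Using the analyticity properties of C′(λ)»)] (functional-analytic plumbing; our proof) -/
theorem differentiableOn_bcf_of_apply {f : ℂ → ι →ᵇ 𝔹} {U : Set ℂ} {M : ℝ} (hU : IsOpen U)
    (hd : ∀ i, DifferentiableOn ℂ (fun t => f t i) U) (hM : ∀ t ∈ U, ‖f t‖ ≤ M) :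
    DifferentiableOn ℂ f U := by
  intro t₀ ht₀
  obtain ⟨ε, hε, hεU⟩ := Metric.isOpen_iff.1 hU t₀ ht₀
  set R : ℝ≥0 := ⟨ε / 2, by positivity⟩ with hRdef
  have hRe : (R : ℝ) = ε / 2 := rfl
  have hR : 0 < R := by
    show (0 : ℝ) < R
    rw [hRe]; positivity
  have hsub : closedBall t₀ (R : ℝ) ⊆ U := by
    refine (closedBall_subset_ball ?_).trans hεU
    rw [hRe]; linarith
  obtain ⟨P, -, hP⟩ := hasFPowerSeriesOnBall_bcf_of_apply hR (fun i => (hd i).mono hsub) fun t ht => hM t (hsub ht)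
  exact hP.analyticAt.differentiableAt.differentiableWithinAt

/-- … hence analytic on `U` (one complex variable, complete codomain).
[cite: Balaban1985RegularSpaces, (1.124) p.97] (functional-analytic plumbing; our proof) -/
theorem analyticOnNhd_bcf_of_apply {f : ℂ → ι →ᵇ 𝔹} {U : Set ℂ} {M : ℝ} (hU : IsOpen U)
    (hd : ∀ i, DifferentiableOn ℂ (fun t => f t i) U) (hM : ∀ t ∈ U, ‖f t‖ ≤ M) :
    AnalyticOnNhd ℂ f U :=
  (differentiableOn_bcf_of_apply hU hd hM).analyticOnNhd hU

end Assembly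

/-! ## §2 «the analyticity properties of `C′(λ)`» in Banach-valued form: `C′` along holomorphic families -/

section Curve

variable {𝔸 : Type*} [NormedRing 𝔸] [NormOneClass 𝔸] [NormedAlgebra ℂ 𝔸] [CompleteSpace 𝔸]

/-- **«Using the analyticity properties of `C′(λ)`» (p. 97; [3] (208)) — BANACH-VALUED, ALONG HOLOMORPHIC FAMILIES.**  Let
`γ : ℂ → (ℤᵈ → 𝔸)` be sitewise holomorphic on an open `V ⊂ ℂ` (`t ↦ γ(t)(x)` complex differentiable on `V` for every site `x`)
with `γ(t)` in the (207)-domain (= (1.120): `‖R(U₀(b))γ(t)(b₊) − γ(t)(b₋)‖ < α₄η`, `‖γ(t)(x)‖ < α₄`, `η = L⁻ᵏ`) for all `t ∈ V`;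
data `U₀` `G`-valued with (52), `u₁ ∈ Λ_k(U₀, α₃)`, the smallness of (214)/`norm_Cnl_le_of207`.  Then `t ↦ C′(γ(t))`, the family
`(C′_j(u₁, γ(t))(z))_{j ≤ k, z}` in the Banach space `XSpace d k 𝔸`, is complex differentiable on `V`.  Proof: every coordinate is
holomorphic by (208) (`analyticAt_Cnl_family`), the family is bounded by `C′₂(α₃ + α₄)α₄` by (1.121) (`norm_Cnl_le_of207`), and §1
assembles.  (The complex line `γ(τ) = λ + τλ₀` of (1.124) is the case print uses.)
[cite: Balaban1985RegularSpaces, (1.124) p.97, (1.120)–(1.121) p.96; Balaban1985Averaging, (208), (214) p.50] -/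
theorem differentiableOn_CnlF_comp {L : ℕ} (hL : 2 ≤ L) {G : Subgroup 𝔸ˣ} (hG : AvgClosed d L G) {U₀ : Site d → Fin d → 𝔸ˣ}
    (hU : ∀ x κ, U₀ x κ ∈ G) {k : ℕ} {γ : ℂ → Site d → 𝔸} {V : Set ℂ} (hV : IsOpen V)
    (hγ : ∀ x, DifferentiableOn ℂ (fun t => γ t x) V)
    {u₁ : Site d → 𝔸ˣ} {α₀ α₃ α₄ : ℝ}
    (hα : 0 < α₀) (hα3 : C0 d * α₀ ≤ 1 / 3) (hα2 : 2 * α₀ ≤ c2' d L)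
    (h52 : pdev U₀ < α₀ * (((L : ℝ) ^ k)⁻¹) ^ 2)
    (h207a : ∀ t ∈ V, ∀ (x : Site d) (κ : Fin d), ‖cj (U₀ x κ) (γ t (x + e κ)) - γ t x‖ < α₄ * ((L : ℝ) ^ k)⁻¹)
    (h207b : ∀ t ∈ V, ∀ x : Site d, ‖γ t x‖ < α₄)
    (hu₁ : InLambda L U₀ u₁ k α₃ (((L : ℝ) ^ k)⁻¹))
    (hα₃ : 0 ≤ α₃) (hα₃' : α₃ ≤ 1 / 200)
    (hs₁ : 200 * C6 d * α₄ ≤ 1) (hs₂ : 12000 * ((d : ℝ) + 1) * L * α₄ ≤ 1) (hs₃ : C4G d L * (α₀ + α₃ + 4 * α₄) ≤ 1)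
    (hs₄ : 1024 * ((d : ℝ) + 1) * ((d : ℝ) + 4) * L ^ 2 * α₀ ≤ 1) (hs₅ : 32 * ((d : ℝ) + 1) ^ 2 * C6 d * L ^ 2 * α₀ ≤ 1)
    (hs₆ : 16 * d * C5' d * C6 d * (L : ℝ) ^ 2 * α₀ ≤ 1) (hs₇ : 8 * d * C6 d * L * α₀ ≤ 1) :
    DifferentiableOn ℂ (fun t => CnlF L U₀ u₁ k (γ t)) V := by
  have hC6 : (0 : ℝ) ≤ C6 d := by unfold C6; linarith [one_le_C5 (d := d)]
  -- on `V` the family is bounded by (1.121)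
  have hpt : ∀ t ∈ V, ∀ p : Fin (k + 1) × Site d, ‖Cnl L U₀ u₁ p.1 (γ t) p.2‖ ≤ C2p d * (α₃ + α₄) * α₄ := fun t ht p =>
    norm_Cnl_le_of207 hL hG hU hα hα3 hα2 h52 (h207a t ht) (h207b t ht) hu₁ hα₃ hα₃' hs₁ hs₂ hs₃ hs₄ hs₅ hs₆ hs₇ p.1
      (Nat.le_of_lt_succ p.1.isLt) p.2
  have hbdd : ∀ t ∈ V, ∃ C : ℝ, ∀ p : Fin (k + 1) × Site d, ‖Cnl L U₀ u₁ p.1 (γ t) p.2‖ ≤ C := fun t ht =>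
    ⟨_, hpt t ht⟩
  have hbound : ∀ t ∈ V, ‖CnlF L U₀ u₁ k (γ t)‖ ≤ C2p d * (α₃ + α₄) * α₄ := fun t ht => by
    have hα₄ : 0 < α₄ := by linarith [norm_nonneg (γ t 0), h207b t ht 0]
    have h0 : 0 ≤ C2p d * (α₃ + α₄) * α₄ := by have := C2p_nonneg d; positivity
    exact (BoundedContinuousFunction.norm_le h0).2 fun p => by rw [CnlF_apply (hbdd t ht)]; exact hpt t ht p
  refine differentiableOn_bcf_of_apply hV (fun p => ?_) hbound
  -- coordinate `p = (j, z)`: `t ↦ C′_j(u₁, γ(t))(z)` is analytic at every `t₁ ∈ V` by (208)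
  intro t₁ ht₁
  have hα₄ : 0 < α₄ := by linarith [norm_nonneg (γ t₁ 0), h207b t₁ ht₁ 0]
  have hΛ : ∀ x, AnalyticAt ℂ (fun t => γ t x) t₁ := fun x => (hγ x).analyticAt (hV.mem_nhds ht₁)
  have hs₁'' : 40 * C6 d * α₄ ≤ 1 := by nlinarith
  have hA := analyticAt_Cnl_family (E := ℂ) (Λ := γ) (t₀ := t₁) hL hG hU hΛ hα hα3 hα2 h52 (h207a t₁ ht₁) (h207b t₁ ht₁)
    hu₁ hα₃ (by linarith) hs₁'' hs₂ hs₃ hs₄ hs₅ hs₆ p.1 (Nat.le_of_lt_succ p.1.isLt) p.2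
  have heq : (fun t => Cnl L U₀ u₁ p.1 (γ t) p.2) =ᶠ[𝓝 t₁] fun t => CnlF L U₀ u₁ k (γ t) p := by
    filter_upwards [hV.mem_nhds ht₁] with t ht
    rw [CnlF_apply (hbdd t ht)]
  exact (hA.congr heq).differentiableAt.differentiableWithinAt

/-- … hence `t ↦ C′(γ(t))` is ANALYTIC on `V` as an `XSpace`-valued map (one complex variable, complete codomain).
[cite: Balaban1985RegularSpaces, (1.124) p.97; Balaban1985Averaging, (208) p.50] -/
theorem analyticOnNhd_CnlF_comp {L : ℕ} (hL : 2 ≤ L) {G : Subgroup 𝔸ˣ} (hG : AvgClosed d L G) {U₀ : Site d → Fin d → 𝔸ˣ}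
    (hU : ∀ x κ, U₀ x κ ∈ G) {k : ℕ} {γ : ℂ → Site d → 𝔸} {V : Set ℂ} (hV : IsOpen V)
    (hγ : ∀ x, DifferentiableOn ℂ (fun t => γ t x) V)
    {u₁ : Site d → 𝔸ˣ} {α₀ α₃ α₄ : ℝ}
    (hα : 0 < α₀) (hα3 : C0 d * α₀ ≤ 1 / 3) (hα2 : 2 * α₀ ≤ c2' d L)
    (h52 : pdev U₀ < α₀ * (((L : ℝ) ^ k)⁻¹) ^ 2)
    (h207a : ∀ t ∈ V, ∀ (x : Site d) (κ : Fin d), ‖cj (U₀ x κ) (γ t (x + e κ)) - γ t x‖ < α₄ * ((L : ℝ) ^ k)⁻¹)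
    (h207b : ∀ t ∈ V, ∀ x : Site d, ‖γ t x‖ < α₄)
    (hu₁ : InLambda L U₀ u₁ k α₃ (((L : ℝ) ^ k)⁻¹))
    (hα₃ : 0 ≤ α₃) (hα₃' : α₃ ≤ 1 / 200)
    (hs₁ : 200 * C6 d * α₄ ≤ 1) (hs₂ : 12000 * ((d : ℝ) + 1) * L * α₄ ≤ 1) (hs₃ : C4G d L * (α₀ + α₃ + 4 * α₄) ≤ 1)
    (hs₄ : 1024 * ((d : ℝ) + 1) * ((d : ℝ) + 4) * L ^ 2 * α₀ ≤ 1) (hs₅ : 32 * ((d : ℝ) + 1) ^ 2 * C6 d * L ^ 2 * α₀ ≤ 1)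
    (hs₆ : 16 * d * C5' d * C6 d * (L : ℝ) ^ 2 * α₀ ≤ 1) (hs₇ : 8 * d * C6 d * L * α₀ ≤ 1) :
    AnalyticOnNhd ℂ (fun t => CnlF L U₀ u₁ k (γ t)) V :=
  (differentiableOn_CnlF_comp hL hG hU hV hγ hα hα3 hα2 h52 h207a h207b hu₁ hα₃ hα₃' hs₁ hs₂ hs₃ hs₄ hs₅ hs₆
    hs₇).analyticOnNhd hV

end Curve

end Literature.MathematicalPhysics.QuantumFieldTheory.Balaban1983to89.B8CprimeCurveAnalytic

end
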